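import Literature.MathematicalPhysics.QuantumFieldTheory.King1986.EndpointCoercivity
import Literature.MathematicalPhysics.QuantumFieldTheory.Balaban1983to89.B5Prop11Plancherel
import Literature.MathematicalPhysics.QuantumFieldTheory.Balaban1983to89.B5Block118

/-!
# King 1986, (4.35)–(4.37) ON THE FINITE TORUS: discrete Plancherel, the block ("Bloch") form of
# `Q*Q`, and (4.33) for translation-invariant operators with King's symbol — the hypotheses of
# `EndpointCoercivity.endpoint_coercive_fibre` DISCHARGED

**Citation header (reproduction of PUBLISHED work; template file of the Bałaban lattice Yang–Mills cell `pub-balaban`,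
TEMPLATE.md §18; companion of `King1986/EndpointCoercivity` v2 §5).**
C. King, *The U(1) Higgs model. I. The continuum limit*, Commun. Math. Phys. **102** (1986) 649–677 [King1986], §4
p. 674, (4.33) and (4.35)–(4.37) (page image `b2b-balaban-template/king-renders/1986-cmp102-king-u1-higgs-I-p026-x2.png`).
The block-diagonal ("Bloch/Floquet") form of operators that are translation invariant only with respect to a
sublattice, and the momentum form of the block-averaging operators `Q`, `Q*Q`, are PRINTED in
T. Bałaban, J. Feldman, H. Knörrer, E. Trubowitz, *Bloch theory for periodic block spin transformations*,
arXiv:1609.00964 (2016) [BFKT16 = bib `BFKT2016Bloch`]: Lemma 1 (a periodic operator `A` on `L²(𝒳_fin)` is block diagonal over the fibres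
`p̂i(p) = k` of the projection `X̂_fin → X̂_crs`), Lemma 9(a) *"(Q^*Qφ)^(p) = conj(q̂(p)) Σ_{p′: π̂(p′) = π̂(p)} q̂(p′) φ̂(p′)"*
and Example 10 (`q̂(p) = Π u_L(ε p_ν)`, `u_L(ω) = L⁻¹ sin(Lω/2)/sin(ω/2)`).  [BFKT16] numbering = arXiv v1: sections
are its `\subsection`s §1–§7 (§2 *Periodic operators…*, §4 *Averaging operators*), and ALL environments share one counter
(`\renewcommand{\thetheorem}{\arabic{theorem}}` in the TeX source `bloch.tex`, fetched read-only into the cell folder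
`b2b-balaban-template/sources/`): Lemma 1 = `lemBOkervar`, Lemma 5 = `lemBOifkervar`, Lemma 7 = `lemBOQ`, Example 8 =
`exBOnaive`, Lemma 9 = `lemBOfourier`, Example 10 = `exBOnaiveCont`.  King's paper and [BFKT16] are TEMPLATE LITERATURE for
the cell, not manuscripts under audit.

**What King prints (p. 674, verbatim).** *"To prove (4.33), we use a Fourier representation on Ω. Since Ω is a torus,
the allowed momenta satisfy p′_μ ∈ 2π|Ω_μ|^{−1}Z, |p′_μ| ≤ π … So Δ^{(k)} has the representation
⟨φ, Δ^{(k)}φ⟩ = |Ω|^{−1} Σ_{p′} |φ̃(p′)|² Δ^{(k)}(p′), (4.35) … Furthermore, ⟨φ, Q*Qφ⟩ = |Ω|^{−1} Σ_{p′} |φ̃(p′)|²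
Π_{μ=1}^d 4L^{−2} sin²(½Lp′_μ)/4 sin²(½p′_μ) ≥ C|Ω|^{−1} Σ_{|p′|≤π/L} |φ̃(p′)|². (4.36)"*  `EndpointCoercivity` v2 located
that (4.36) with "=" is NOT a quadratic-form identity for `L ≥ 2` (`Q*Q` is block-diagonal over the alias fibres
`{p′ + 2πm/L}`, not diagonal) and proved the conclusion (4.33) FIBREWISE (`fibre437`, `endpoint_coercive_fibre`), leaving
as HYPOTHESES the block-diagonal Fourier representation itself (`hform`, `hpars`), the fibre geometry (`hz`, `hq`, `hoff`)
and the alias-weight facts (`hu₀`, `hpar`).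

**What this file PROVES (kernel; `Ω = Π_μ ℤ/(L·M_μ)ℤ`, any `d`, block size `L ≥ 1`, any numbers `M_μ ≥ 1` of blocks
per direction; the torus, its characters `chi`, their orthogonality `sum_chi` and the reduced momenta `sOf` are REUSED
from `Balaban1983to89.B5Prop11Plancherel`, the in-block offsets `iota`, `chi_zero_right` from `Balaban1983to89.B5Block118`
(b05 lineage: the block average `Q : fine → coarse` and its DFT `dft_QsOp`; bridges `corner_eq_up`, `site_eq_bpt`).**
* §1 (any finite torus `Π ℤ/N_μ`): Fourier coefficients `ft x p = φ̃(p) = Σ_y φ(y) e^{−ip·y}` of a real field;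
  PLANCHEREL `Σ_p |φ̃(p)|² = |Ω| Σ_y φ(y)²` (`parseval`, `parseval_dot`); inversion; the transfer of a quadratic form to
  momentum space (`transfer`: `|Ω|²⟨φ, Tφ⟩ = Σ_{p,p′} φ̃(p) conj φ̃(p′) T̂(p,p′)`, `T̂(p,p′) = Σ_{y,y′} e^{ip·y}T_{yy′}e^{−ip′·y′}`
  — [BFKT16] §2 eq. (3) `Â(p,p′)`); and **(4.35): every `Ω`-translation-invariant real operator `T` is diagonal in plane
  waves**, `|Ω|⟨φ, Tφ⟩ = Σ_p σ_T(p)|φ̃(p)|²` with the real symbol `σ_T(p) = Σ_z T_{z0} cos(p·z)` (`hat_of_transl`,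
  `transl_form`, `symb`).
* §2 (blocks): the sites `y = L·b + j` (`site`, a bijection `blockEquiv : Tor M × (Fin d → Fin L) ≃ Ω`), the
  BLOCK-MEAN PROJECTOR `Q*Q` (`blockProj y y′ = L^{−d}·[y, y′ in the same L-block]`, i.e. `(Q*Qφ)(u) = (Qφ)(ξ(u))`,
  [BFKT16] Example 8) with `⟨φ, Q*Qφ⟩ = L^{−d} Σ_b (Σ_{y∈b} φ(y))²` (`blockProj_form`) and `0 ≤ ⟨φ,Q*Qφ⟩ ≤ ⟨φ,φ⟩`;
  the duality `e^{ip·(Lb)} = e^{i red(p)·b}` between block corners and the reduction `red : Ω̂ → M̂` of momenta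
  (`chi_corner`), hence `Q̂*Q(p,p′) = |Ω|·[red p = red p′]·u(p) conj u(p′)` (`hat_blockProj_eq`) with the alias weight
  `u(p) = L^{−d} Σ_{j∈[0,L)^d} e^{ip·j}`, and **the CORRECT form of (4.36): `|Ω|⟨φ, Q*Qφ⟩ = Σ_{q∈M̂} |Σ_{p: red p = q}
  u(p) φ̃(p)|²`** (`blockProj_fibre_form`) — [BFKT16] Lemma 9(a) for King's `Q`.
* §3 (fibre geometry): the central alias `z q = (valMinAbs q_μ)_μ` of the fibre over `q` lies in the fibre and in
  `|p′_μ| ≤ π/L` (`red_z`, `abs_sOf_z_le`); every OTHER alias of the fibre has a coordinate with `|p′_μ| ≥ π/L`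
  (`off_centre`).
* §4 (weights): `|u(p)|² = qqSymbol L p′ = Π_μ sin²(Lp′_μ/2)/(L² sin²(p′_μ/2))` (`norm_sq_u`, via the tree's Dirichlet-sum
  identity `AliasingIdentity.norm_dirichletSum_sq_mul_sin_sq`), hence `|u(z q)|² ≥ (4/π²)^d` (`norm_sq_u_central`,
  from `EndpointCoercivity.qqSymbol_ge`); and the fibre Parseval `Σ_{p: red p = q} |u(p)|² = 1` EXACTLY
  (`sum_fib_norm_sq_u`, by character orthogonality on `Ω̂` and `M̂` — [BFKT16] Lemma 9(a) `QQ* = 1` for Example 8).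
* §5 (assembly): for ANY real `Ω`-translation-invariant `T₁`, `T₀` whose symbols are King's
  `Δ^{(k)}(p′) = DeltaEff a_k L^k m (p′)`, `Δ^{(k+n)}(p′)` (tree `King1986.DeltaEff`, (4.5)), BOTH
  `T₁ + aL⁻²Q*Q` and `T₀ + aL⁻²Q*Q` are `Coercive` with the explicit `γ₀^F = gamma0F L a_min a d` of `EndpointCoercivity`
  (`endpoint_coercive_torus`; one-operator form `coercive_torus`) — hypothesis (a) of `King1986.lemma45` — with `hform`,
  `hpars`, `hz`, `hq`, `hoff`, `hu₀`, `hpar` of `endpoint_coercive_fibre` ALL DERIVED here (`form_decomp`, `pars_decomp`).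

**What remains an input (stated, not smuggled).**  Only the identification of the SYMBOL: that King's `Δ^{(k)}` — which
is `Ω`-translation invariant by construction (block RG with `L^k`-blocks commutes with unit translations) — has plane-wave
symbol (4.5) `= DeltaEff` (King p. 670, from [Ba 4] = [Balaban1983RegularityDecay] §2; the tree proves (4.5)'s
composition law and rate at the symbol level in `King1986/CompositionLaw`, `…/CompositionRate`, not the Gaussian
integration producing it).  It enters §5 as the hypotheses `hσ₁`, `hσ₀` on otherwise arbitrary translation-invariant
`T₁`, `T₀`.  NOT COVERED: free boundary conditions; `A ≠ 0`; block profiles other than the flat one (King's).  No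
`def … : Prop` is introduced; every declaration is a definition with a body or a proved theorem.

**How the cell uses this (pointer, not a ruling).**  Closes TEMPLATE §18.9's residual "block-diagonal representation +
fibre geometry remain hypotheses": King's (4.33) at `A = 0` is now kernel-proved for the operator class
{translation-invariant `Δ` with symbol (4.5)} + `aL⁻²Q*Q` on every torus `Π ℤ/(LM_μ)`, uniformly in `k`, `n`, `M`.
For Bałaban's background-dependent operators (T4-DAG NE2⁺) there is no Fourier representation and nothing here
applies.  Value = kernel reproduction of a printed `A = 0` estimate (and of the standard Bloch decomposition it rests
on), NOT summit progress.
-/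

noncomputable section

open Finset Real Matrix
open scoped BigOperators ComplexConjugate

namespace Literature.MathematicalPhysics.QuantumFieldTheory.King1986

open Literature.MathematicalPhysics.QuantumFieldTheory.Balaban1983to89
open Literature.MathematicalPhysics.QuantumFieldTheory.Balaban1983to89.B5Prop11Plancherel

namespace Torus

variable {d : ℕ}

/-! ## §1 Characters, Fourier coefficients and Plancherel on a finite torus `Π_μ ℤ/N_μℤ` -/

section General

variable (N : Fin d → ℕ) [hN : ∀ μ, NeZero (N μ)]

/-- `e^{ip·x} = e^{ix·p}`. [folklore] -/
theorem chi_comm (p x : Tor N) : chi N p x = chi N x p := by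
  unfold chi
  exact Finset.prod_congr rfl fun μ _ => by rw [mul_comm]

/-- `e^{i(−p)·x} = e^{ip·(−x)}`. [folklore] -/
theorem chi_neg_left (p x : Tor N) : chi N (-p) x = chi N p (-x) := by
  unfold chi
  refine Finset.prod_congr rfl fun μ _ => ?_
  rw [Pi.neg_apply, Pi.neg_apply, neg_mul, mul_neg]

/-- `conj e^{ip·x} · e^{ip·y} = e^{ip·(y − x)}`. [folklore] -/
theorem conj_chi_mul_chi (p x y : Tor N) : conj (chi N p x) * chi N p y = chi N p (y - x) := by
  rw [conj_chi, chi_neg_left, ← chi_add_right, neg_add_eq_sub]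

/-- `e^{ip·x} · conj e^{iq·x} = e^{i(p − q)·x}`. [folklore] -/
theorem chi_mul_conj_chi_left (p q x : Tor N) : chi N p x * conj (chi N q x) = chi N (p - q) x := by
  rw [conj_chi, ← chi_add_left, ← sub_eq_add_neg]

/-- `e^{ip·x} · conj e^{ip·y} = e^{ip·(x − y)}`. [folklore] -/
theorem chi_mul_conj_chi (p x y : Tor N) : chi N p x * conj (chi N p y) = chi N p (x - y) := by
  rw [mul_comm, conj_chi_mul_chi]

/-- Character orthogonality in the first slot: `Σ_p e^{ip·w} = |T|·δ_{w,0}`. [folklore] -/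
theorem sum_chi_left (w : Tor N) :
    ∑ p : Tor N, chi N p w = if w = 0 then (Fintype.card (Tor N) : ℂ) else 0 := by
  simp_rw [chi_comm N _ w]
  exact sum_chi N w

/-- **Plancherel for character sums**: `Σ_b |Σ_q A_q e^{iq·b}|² = |T| Σ_q |A_q|²`. [folklore] -/
theorem sum_norm_sq_charSum (A : Tor N → ℂ) :
    ∑ b : Tor N, ‖∑ q : Tor N, A q * chi N q b‖ ^ 2
      = Fintype.card (Tor N) * ∑ q : Tor N, ‖A q‖ ^ 2 := by
  have hC : ∑ b : Tor N, ((‖∑ q : Tor N, A q * chi N q b‖ : ℂ) ^ 2)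
      = (Fintype.card (Tor N) : ℂ) * ∑ q : Tor N, ((‖A q‖ : ℂ) ^ 2) := by
    simp_rw [← Complex.mul_conj']
    calc ∑ b : Tor N, (∑ q, A q * chi N q b) * conj (∑ q, A q * chi N q b)
        = ∑ b : Tor N, ∑ q, ∑ q', A q * conj (A q') * chi N (q - q') b := by
          refine Finset.sum_congr rfl fun b _ => ?_
          rw [map_sum, Finset.sum_mul_sum]
          refine Finset.sum_congr rfl fun q _ => Finset.sum_congr rfl fun q' _ => ?_
          rw [map_mul, ← chi_mul_conj_chi_left]
          ring
      _ = ∑ q, ∑ q', A q * conj (A q') * ∑ b : Tor N, chi N (q - q') b := by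
          rw [Finset.sum_comm]
          refine Finset.sum_congr rfl fun q _ => ?_
          rw [Finset.sum_comm]
          refine Finset.sum_congr rfl fun q' _ => ?_
          rw [Finset.mul_sum]
      _ = ∑ q, A q * conj (A q) * (Fintype.card (Tor N) : ℂ) := by
          refine Finset.sum_congr rfl fun q _ => ?_
          rw [Finset.sum_eq_single q]
          · rw [sub_self, sum_chi, if_pos rfl]
          · intro q' _ hq'
            rw [sum_chi, if_neg (sub_ne_zero.mpr (Ne.symm hq')), mul_zero]
          · intro h; exact absurd (Finset.mem_univ q) h
      _ = (Fintype.card (Tor N) : ℂ) * ∑ q, A q * conj (A q) := by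
          rw [Finset.mul_sum]
          exact Finset.sum_congr rfl fun q _ => by ring
  exact_mod_cast hC

/-- King's Fourier transform of a real field on the torus, `φ̃(p) = Σ_y φ(y) e^{−ip·y}` (unnormalised, as in (4.35),
where the form carries the factor `|Ω|⁻¹`). [cite: King1986, (4.35) p.674] -/
def ft (x : Tor N → ℝ) (p : Tor N) : ℂ := ∑ y, (x y : ℂ) * conj (chi N p y)

/-- `φ̃(p) = Σ_y φ(−y) e^{iy·p}` (a character sum in the shape of `sum_norm_sq_charSum`). [folklore] -/
theorem ft_eq_charSum (x : Tor N → ℝ) (p : Tor N) :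
    ft N x p = ∑ y : Tor N, ((x (-y) : ℝ) : ℂ) * chi N y p := by
  unfold ft
  refine Fintype.sum_equiv (Equiv.neg (Tor N)) _ _ fun y => ?_
  rw [Equiv.neg_apply, neg_neg, conj_chi, chi_neg_left, chi_comm N (-y) p]

/-- **Plancherel / (4.35) for the identity**: `Σ_p |φ̃(p)|² = |Ω| Σ_y φ(y)²`, i.e.
`⟨φ, φ⟩ = |Ω|⁻¹ Σ_p |φ̃(p)|²`. [cite: King1986, (4.35) p.674] -/
theorem parseval (x : Tor N → ℝ) :
    ∑ p : Tor N, ‖ft N x p‖ ^ 2 = Fintype.card (Tor N) * ∑ y, x y ^ 2 := by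
  simp_rw [ft_eq_charSum]
  rw [sum_norm_sq_charSum]
  congr 1
  refine Fintype.sum_equiv (Equiv.neg (Tor N)) _ _ fun y => ?_
  rw [Equiv.neg_apply, Complex.norm_real, Real.norm_eq_abs, sq_abs]

/-- Plancherel in dot-product form: `|Ω|·(x ⬝ᵥ x) = Σ_p |φ̃(p)|²`. [folklore] -/
theorem parseval_dot (x : Tor N → ℝ) :
    (Fintype.card (Tor N) : ℝ) * (x ⬝ᵥ x) = ∑ p : Tor N, ‖ft N x p‖ ^ 2 := by
  rw [parseval]
  congr 1
  simp [dotProduct, sq]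

/-- Fourier inversion: `Σ_p φ̃(p) e^{ip·y} = |Ω| φ(y)`. [folklore] -/
theorem inversion (x : Tor N → ℝ) (y : Tor N) :
    ∑ p : Tor N, ft N x p * chi N p y = Fintype.card (Tor N) * (x y : ℂ) := by
  unfold ft
  simp_rw [Finset.sum_mul]
  rw [Finset.sum_comm]
  have h : ∀ y' : Tor N, ∑ p : Tor N, (x y' : ℂ) * conj (chi N p y') * chi N p y
      = (x y' : ℂ) * (if y - y' = 0 then (Fintype.card (Tor N) : ℂ) else 0) := by
    intro y'
    rw [← sum_chi_left N (y - y'), Finset.mul_sum]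
    refine Finset.sum_congr rfl fun p _ => ?_
    rw [mul_assoc, conj_chi_mul_chi]
  simp_rw [h]
  rw [Finset.sum_eq_single y]
  · rw [sub_self, if_pos rfl, mul_comm]
  · intro y' _ hy'
    rw [if_neg (sub_ne_zero.mpr (Ne.symm hy')), mul_zero]
  · intro h; exact absurd (Finset.mem_univ y) h

/-- Conjugate inversion (the field is real): `Σ_p conj φ̃(p) e^{−ip·y} = |Ω| φ(y)`. [folklore] -/
theorem inversion_conj (x : Tor N → ℝ) (y : Tor N) :
    ∑ p : Tor N, conj (ft N x p) * conj (chi N p y) = Fintype.card (Tor N) * (x y : ℂ) := by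
  have h := congrArg (starRingEnd ℂ) (inversion N x y)
  simp only [map_sum, map_mul, map_natCast, Complex.conj_ofReal] at h
  exact h

/-- The momentum-space kernel of a real operator, `T̂(p, p′) = Σ_{y,y′} e^{ip·y} T_{yy′} e^{−ip′·y′}`
([BFKT16] §2 eq. (3) `Â(p,p′)`, up to their volume prefactor). [cite: BFKT2016Bloch, §2] -/
def hat (T : Matrix (Tor N) (Tor N) ℝ) (p p' : Tor N) : ℂ :=
  ∑ y, ∑ y', chi N p y * (T y y' : ℂ) * conj (chi N p' y')

/-- `⟨x, Tx⟩` as a double sum (cast to `ℂ`). [folklore] -/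
theorem dot_mulVec_eq (T : Matrix (Tor N) (Tor N) ℝ) (x : Tor N → ℝ) :
    ((x ⬝ᵥ (T *ᵥ x) : ℝ) : ℂ) = ∑ y, ∑ y', (x y : ℂ) * (T y y' : ℂ) * (x y' : ℂ) := by
  simp only [dotProduct, Matrix.mulVec, Finset.mul_sum]
  push_cast
  exact Finset.sum_congr rfl fun y _ => Finset.sum_congr rfl fun y' _ => by ring

omit hN in
/-- Exchange of a fourfold sum. [folklore] -/
theorem sum_comm4 {α β : Type*} [Fintype α] [Fintype β] (f : α → α → β → β → ℂ) :
    ∑ y, ∑ y', ∑ p, ∑ p', f y y' p p' = ∑ p, ∑ p', ∑ y, ∑ y', f y y' p p' := by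
  calc ∑ y, ∑ y', ∑ p, ∑ p', f y y' p p'
      = ∑ y, ∑ p, ∑ y', ∑ p', f y y' p p' :=
        Finset.sum_congr rfl fun _ _ => Finset.sum_comm
    _ = ∑ p, ∑ y, ∑ y', ∑ p', f y y' p p' := Finset.sum_comm
    _ = ∑ p, ∑ y, ∑ p', ∑ y', f y y' p p' :=
        Finset.sum_congr rfl fun _ _ => Finset.sum_congr rfl fun _ _ => Finset.sum_comm
    _ = ∑ p, ∑ p', ∑ y, ∑ y', f y y' p p' :=
        Finset.sum_congr rfl fun _ _ => Finset.sum_comm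

/-- **Transfer of a quadratic form to momentum space**:
`|Ω|² ⟨x, Tx⟩ = Σ_{p,p′} φ̃(p) conj φ̃(p′) T̂(p,p′)` (from the inversion formula). [cite: BFKT2016Bloch, Lemma 1] -/
theorem transfer (T : Matrix (Tor N) (Tor N) ℝ) (x : Tor N → ℝ) :
    (Fintype.card (Tor N) : ℂ) ^ 2 * ((x ⬝ᵥ (T *ᵥ x) : ℝ) : ℂ)
      = ∑ p, ∑ p', ft N x p * conj (ft N x p') * hat N T p p' := by
  have hR : ∑ p, ∑ p', ft N x p * conj (ft N x p') * hat N T p p'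
      = ∑ y, ∑ y', (∑ p, ft N x p * chi N p y) * (T y y' : ℂ)
          * (∑ p', conj (ft N x p') * conj (chi N p' y')) := by
    unfold hat
    symm
    calc ∑ y, ∑ y', (∑ p, ft N x p * chi N p y) * (T y y' : ℂ)
          * (∑ p', conj (ft N x p') * conj (chi N p' y'))
        = ∑ y, ∑ y', ∑ p, ∑ p',
            ft N x p * conj (ft N x p') * (chi N p y * (T y y' : ℂ) * conj (chi N p' y')) := by
          refine Finset.sum_congr rfl fun y _ => Finset.sum_congr rfl fun y' _ => ?_
          rw [Finset.sum_mul, Finset.sum_mul_sum]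
          exact Finset.sum_congr rfl fun p _ => Finset.sum_congr rfl fun p' _ => by ring
      _ = ∑ p, ∑ p', ∑ y, ∑ y',
            ft N x p * conj (ft N x p') * (chi N p y * (T y y' : ℂ) * conj (chi N p' y')) :=
          sum_comm4 _
      _ = ∑ p, ∑ p', ft N x p * conj (ft N x p')
            * ∑ y, ∑ y', chi N p y * (T y y' : ℂ) * conj (chi N p' y') := by
          refine Finset.sum_congr rfl fun p _ => Finset.sum_congr rfl fun p' _ => ?_
          rw [Finset.mul_sum]
          exact Finset.sum_congr rfl fun y _ => by rw [Finset.mul_sum]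
  rw [hR, dot_mulVec_eq, Finset.mul_sum]
  refine Finset.sum_congr rfl fun y _ => ?_
  rw [Finset.mul_sum]
  refine Finset.sum_congr rfl fun y' _ => ?_
  rw [inversion, inversion_conj]
  ring

/-- The real Fourier SYMBOL of a translation-invariant operator, `σ_T(p) = Σ_z T_{z,0} cos(p·z)` (the discrete
Fourier transform of its kernel row; for King's `Δ^{(k)}` this is (4.5), tree `King1986.DeltaEff`).
[cite: King1986, (4.5) p.670, (4.35) p.674] -/
def symb (T : Matrix (Tor N) (Tor N) ℝ) (p : Tor N) : ℝ := ∑ z, T z 0 * (chi N p z).re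

/-- The momentum kernel of a TRANSLATION-INVARIANT operator is diagonal:
`T̂(p,p′) = (Σ_z T_{z0} e^{ip·z}) · |Ω| δ_{p,p′}` ([BFKT16] Lemma 5(b) with `𝒳_crs = 𝒳_fin`). [cite: BFKT2016Bloch, Lemma 5(b)] -/
theorem hat_of_transl (T : Matrix (Tor N) (Tor N) ℝ) (hT : ∀ x y t, T (x + t) (y + t) = T x y)
    (p p' : Tor N) :
    hat N T p p' = (∑ z, (T z 0 : ℂ) * chi N p z)
      * (if p - p' = 0 then (Fintype.card (Tor N) : ℂ) else 0) := by
  have hK : ∀ y y' : Tor N, T y y' = T (y - y') 0 := fun y y' => by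
    have h := hT (y - y') 0 y'
    rw [sub_add_cancel, zero_add] at h
    exact h
  unfold hat
  rw [Finset.sum_comm]
  calc ∑ y', ∑ y, chi N p y * (T y y' : ℂ) * conj (chi N p' y')
      = ∑ y', ∑ z, chi N p (z + y') * (T z 0 : ℂ) * conj (chi N p' y') := by
        refine Finset.sum_congr rfl fun y' _ => ?_
        refine Fintype.sum_equiv (Equiv.subRight y') _ _ fun y => ?_
        rw [Equiv.subRight_apply, sub_add_cancel, ← hK y y']
    _ = ∑ y', ∑ z, ((T z 0 : ℂ) * chi N p z) * (chi N p y' * conj (chi N p' y')) := by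
        refine Finset.sum_congr rfl fun y' _ => Finset.sum_congr rfl fun z _ => ?_
        rw [chi_add_right]
        ring
    _ = (∑ z, (T z 0 : ℂ) * chi N p z) * ∑ y', chi N (p - p') y' := by
        rw [Finset.sum_comm, Finset.sum_mul_sum]
        refine Finset.sum_congr rfl fun z _ => Finset.sum_congr rfl fun y' _ => ?_
        rw [chi_mul_conj_chi_left]
    _ = _ := by rw [sum_chi]

/-- **(4.35): a translation-invariant real operator on the torus is diagonal in plane waves**,
`|Ω| ⟨φ, Tφ⟩ = Σ_p σ_T(p) |φ̃(p)|²`, i.e. `⟨φ, Tφ⟩ = |Ω|⁻¹ Σ_{p′} |φ̃(p′)|² σ_T(p′)`.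
[cite: King1986, (4.35) p.674; BFKT2016Bloch, Lemma 1 / Lemma 5(b)] -/
theorem transl_form (T : Matrix (Tor N) (Tor N) ℝ) (hT : ∀ x y t, T (x + t) (y + t) = T x y)
    (x : Tor N → ℝ) :
    (Fintype.card (Tor N) : ℝ) * (x ⬝ᵥ (T *ᵥ x)) = ∑ p : Tor N, symb N T p * ‖ft N x p‖ ^ 2 := by
  have hc : (Fintype.card (Tor N) : ℂ) ≠ 0 := by exact_mod_cast Fintype.card_ne_zero
  have hC : (((Fintype.card (Tor N) : ℝ) * (x ⬝ᵥ (T *ᵥ x)) : ℝ) : ℂ)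
      = ∑ p, (∑ z, (T z 0 : ℂ) * chi N p z) * ((‖ft N x p‖ : ℂ) ^ 2) := by
    have h := transfer N T x
    simp_rw [hat_of_transl N T hT] at h
    have h2 : ∑ p, ∑ p', ft N x p * conj (ft N x p')
          * ((∑ z, (T z 0 : ℂ) * chi N p z) * (if p - p' = 0 then (Fintype.card (Tor N) : ℂ) else 0))
        = (Fintype.card (Tor N) : ℂ) * ∑ p, (∑ z, (T z 0 : ℂ) * chi N p z) * ((‖ft N x p‖ : ℂ) ^ 2) := by
      rw [Finset.mul_sum]
      refine Finset.sum_congr rfl fun p _ => ?_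
      rw [Finset.sum_eq_single p]
      · rw [sub_self, if_pos rfl, ← Complex.mul_conj']
        ring
      · intro p' _ hp'
        rw [if_neg (sub_ne_zero.mpr (Ne.symm hp')), mul_zero, mul_zero]
      · intro h; exact absurd (Finset.mem_univ p) h
    rw [h2, pow_two, mul_assoc] at h
    have h3 := mul_left_cancel₀ hc h
    push_cast
    exact h3
  have hre : ∀ p, (∑ z, (T z 0 : ℂ) * chi N p z).re = symb N T p := fun p => by
    unfold symb
    rw [Complex.re_sum]
    exact Finset.sum_congr rfl fun z _ => Complex.re_ofReal_mul _ _
  have hfin := congrArg Complex.re hC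
  rw [Complex.ofReal_re, Complex.re_sum] at hfin
  rw [hfin]
  refine Finset.sum_congr rfl fun p _ => ?_
  rw [← Complex.ofReal_pow, Complex.re_mul_ofReal, hre]

end General

/-! ## §2 `L`-blocks on `Ω = Π_μ ℤ/(L·M_μ)ℤ`: sites `y = L·b + j`, the block-mean projector `Q*Q`, and its
momentum kernel over the alias fibres -/

section Blocks

variable (L : ℕ) [NeZero L] (M : Fin d → ℕ) [hM : ∀ μ, NeZero (M μ)]

/-- The site `y_μ = L·b_μ + j_μ` of block `b ∈ Π ℤ/M_μ` at offset `j ∈ [0, L)^d`. [folklore] -/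
def site (b : Tor M) (j : Fin d → Fin L) : Tor (fine L M) :=
  fun μ => ((L * (b μ).val + (j μ : ℕ) : ℕ) : ZMod (fine L M μ))

omit [NeZero L] in
/-- `val (L·b_μ + j_μ) = L·val(b_μ) + j_μ` (no wrap-around). [folklore] -/
theorem val_site (b : Tor M) (j : Fin d → Fin L) (μ : Fin d) :
    (site L M b j μ).val = L * (b μ).val + (j μ : ℕ) := by
  unfold site
  rw [ZMod.val_natCast, Nat.mod_eq_of_lt]
  have hb : (b μ).val < M μ := ZMod.val_lt _
  have hj : (j μ : ℕ) < L := (j μ).isLt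
  show L * (b μ).val + (j μ : ℕ) < L * M μ
  calc L * (b μ).val + (j μ : ℕ) < L * (b μ).val + L := by omega
    _ = L * ((b μ).val + 1) := by ring
    _ ≤ L * M μ := Nat.mul_le_mul_left _ hb

/-- `(b, j) ↦ L·b + j` is injective. [folklore] -/
theorem site_injective :
    Function.Injective (fun bj : Tor M × (Fin d → Fin L) => site L M bj.1 bj.2) := by
  rintro ⟨b, j⟩ ⟨b', j'⟩ h
  have hL : 0 < L := Nat.pos_of_ne_zero (NeZero.ne L)
  have hμ : ∀ μ, b μ = b' μ ∧ j μ = j' μ := by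
    intro μ
    have hv : (site L M b j μ).val = (site L M b' j' μ).val :=
      congrArg ZMod.val (congr_fun h μ)
    rw [val_site, val_site] at hv
    have hj : (j μ : ℕ) < L := (j μ).isLt
    have hj' : (j' μ : ℕ) < L := (j' μ).isLt
    have h1 : (b μ).val = (b' μ).val := by
      have h2 : (L * (b μ).val + (j μ : ℕ)) / L = (L * (b' μ).val + (j' μ : ℕ)) / L :=
        congrArg (· / L) hv
      rwa [Nat.mul_add_div hL, Nat.mul_add_div hL, Nat.div_eq_of_lt hj, Nat.div_eq_of_lt hj',
        add_zero, add_zero] at h2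
    have h3 : (j μ : ℕ) = (j' μ : ℕ) := by
      rw [h1] at hv
      omega
    exact ⟨ZMod.val_injective _ h1, Fin.ext h3⟩
  exact Prod.ext (funext fun μ => (hμ μ).1) (funext fun μ => (hμ μ).2)

/-- `|Π ℤ/M_μ × [0,L)^d| = |Π ℤ/(LM_μ)|`. [folklore] -/
theorem card_blocks :
    Fintype.card (Tor M × (Fin d → Fin L)) = Fintype.card (Tor (fine L M)) := by
  simp only [Fintype.card_prod, Fintype.card_pi, ZMod.card, Fintype.card_fin, Finset.prod_const,
    Finset.card_univ, fine]
  rw [Finset.prod_mul_distrib, Finset.prod_const, Finset.card_univ, Fintype.card_fin]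
  ring

/-- `|Ω| = L^d · |Π ℤ/M_μ|` (as complex numbers). [folklore] -/
theorem card_fine :
    (Fintype.card (Tor (fine L M)) : ℂ) = (L : ℂ) ^ d * Fintype.card (Tor M) := by
  rw [← card_blocks L M, Fintype.card_prod, Fintype.card_fun, Fintype.card_fin, Fintype.card_fin]
  push_cast
  ring

/-- `(b, j) ↦ L·b + j` is a bijection onto `Ω`. [folklore] -/
theorem site_bijective :
    Function.Bijective (fun bj : Tor M × (Fin d → Fin L) => site L M bj.1 bj.2) :=
  (Fintype.bijective_iff_injective_and_card _).mpr ⟨site_injective L M, card_blocks L M⟩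

/-- The block parametrisation `Π ℤ/M_μ × [0,L)^d ≃ Ω`. [folklore] -/
def blockEquiv : Tor M × (Fin d → Fin L) ≃ Tor (fine L M) :=
  Equiv.ofBijective _ (site_bijective L M)

/-- `blockEquiv (b, j) = L·b + j`. [folklore] -/
@[simp] theorem blockEquiv_apply (b : Tor M) (j : Fin d → Fin L) :
    blockEquiv L M (b, j) = site L M b j := rfl

/-- The block `⌊y/L⌋ ∈ Π ℤ/M_μ` containing the site `y`. [folklore] -/
def blockOf (y : Tor (fine L M)) : Tor M := ((blockEquiv L M).symm y).1

/-- `⌊(L·b + j)/L⌋ = b`. [folklore] -/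
theorem blockOf_site (b : Tor M) (j : Fin d → Fin L) : blockOf L M (site L M b j) = b := by
  unfold blockOf
  rw [← blockEquiv_apply, Equiv.symm_apply_apply]

/-- The corner `L·b` of block `b`. [folklore] -/
def corner (b : Tor M) : Tor (fine L M) := fun μ => ((L * (b μ).val : ℕ) : ZMod (fine L M μ))

omit [NeZero L] hM in
/-- `L·b + j = corner b + iota j` (`iota` = the in-block offset of `B5Block118`, b05 lineage). [folklore] -/
theorem site_eq (b : Tor M) (j : Fin d → Fin L) : site L M b j = corner L M b + B5Block118.iota L M j := by
  funext μ
  simp only [site, corner, B5Block118.iota, Pi.add_apply, Nat.cast_add]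

omit [NeZero L] hM in
/-- `corner 0 = 0`. [folklore] -/
theorem corner_zero : corner L M 0 = 0 := by
  funext μ
  simp [corner]

omit [NeZero L] in
/-- BRIDGE to the b05 lineage's vocabulary: `corner b = B5Block118.up b` (the unit-lattice point read on the fine
lattice, there for `Q_k : fine → coarse` and its DFT `B5Block118.dft_QsOp`). [folklore] -/
theorem corner_eq_up (b : Tor M) : corner L M b = B5Block118.up L M b := by
  funext ν
  have h : b ν = (((b ν).val : ℤ) : ZMod (M ν)) := by rw [Int.cast_natCast, ZMod.natCast_zmod_val]
  simp only [corner, B5Block118.up]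
  conv_rhs => rw [h, B5Block118.upHom_intCast]
  push_cast
  ring

omit [NeZero L] in
/-- BRIDGE: `site b j = B5Block118.bpt b j` (the block point `n·y + j` of B5 (1.6)/(1.18)). [folklore] -/
theorem site_eq_bpt (b : Tor M) (j : Fin d → Fin L) : site L M b j = B5Block118.bpt L M b j := by
  rw [site_eq, corner_eq_up]
  rfl

/-- **King's `Q*Q`: the BLOCK-MEAN PROJECTOR** `(Q*Q)_{yy′} = L^{−d}` if `y`, `y′` lie in the same `L`-block, `0`
otherwise (`(Q*Qφ)(u) = (Qφ)(ξ(u)) = L^{−d} Σ_{u′ ∈ □_{ξ(u)}} φ(u′)`). [cite: King1986, (4.36) p.674; BFKT2016Bloch, Example 8] -/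
def blockProj : Matrix (Tor (fine L M)) (Tor (fine L M)) ℝ :=
  fun y y' => if blockOf L M y = blockOf L M y' then ((L : ℝ) ^ d)⁻¹ else 0

/-- The block sum `Σ_{y ∈ block b} φ(y)`. [folklore] -/
def blockSum (x : Tor (fine L M) → ℝ) (b : Tor M) : ℝ := ∑ j : Fin d → Fin L, x (site L M b j)

/-- Bilinear form of `Q*Q` against arbitrary complex test functions:
`Σ_{y,y′} f(y) (Q*Q)_{yy′} g(y′) = L^{−d} Σ_b (Σ_{y∈b} f)(Σ_{y′∈b} g)`. [folklore] -/
theorem blockProj_bilin (f g : Tor (fine L M) → ℂ) :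
    ∑ y, ∑ y', f y * (blockProj L M y y' : ℂ) * g y'
      = ((((L : ℝ) ^ d)⁻¹ : ℝ) : ℂ) * ∑ b, (∑ j, f (site L M b j)) * (∑ j, g (site L M b j)) := by
  set c : ℝ := ((L : ℝ) ^ d)⁻¹ with hc
  have h1 : ∑ y, ∑ y', f y * (blockProj L M y y' : ℂ) * g y'
      = ∑ bj : Tor M × (Fin d → Fin L), ∑ bj' : Tor M × (Fin d → Fin L),
          f (site L M bj.1 bj.2) * ((if bj.1 = bj'.1 then c else 0 : ℝ) : ℂ)
            * g (site L M bj'.1 bj'.2) := by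
    symm
    refine Fintype.sum_equiv (blockEquiv L M) _ _ fun bj => ?_
    refine Fintype.sum_equiv (blockEquiv L M) _ _ fun bj' => ?_
    obtain ⟨b, j⟩ := bj
    obtain ⟨b', j'⟩ := bj'
    simp only [blockEquiv_apply, blockProj, blockOf_site, hc]
  rw [h1, Fintype.sum_prod_type, Finset.mul_sum]
  refine Finset.sum_congr rfl fun b _ => ?_
  simp_rw [Fintype.sum_prod_type]
  have h2 : ∀ j : Fin d → Fin L,
      ∑ b' : Tor M, ∑ j' : Fin d → Fin L,
        f (site L M b j) * ((if b = b' then c else 0 : ℝ) : ℂ) * g (site L M b' j')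
        = (c : ℂ) * (f (site L M b j) * ∑ j', g (site L M b j')) := by
    intro j
    rw [Finset.sum_eq_single b]
    · rw [if_pos rfl, Finset.mul_sum, Finset.mul_sum]
      exact Finset.sum_congr rfl fun j' _ => by ring
    · intro b' _ hb'
      rw [if_neg (Ne.symm hb')]
      simp
    · intro h; exact absurd (Finset.mem_univ b) h
  simp_rw [h2]
  rw [← Finset.mul_sum, ← Finset.sum_mul]

/-- **`⟨φ, Q*Qφ⟩ = L^{−d} Σ_b (Σ_{y∈b} φ(y))²`** (`= Σ_b L^d |block mean|²`). [cite: King1986, p.674; BFKT2016Bloch, Example 8] -/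
theorem blockProj_form (x : Tor (fine L M) → ℝ) :
    x ⬝ᵥ (blockProj L M *ᵥ x) = ((L : ℝ) ^ d)⁻¹ * ∑ b, blockSum L M x b ^ 2 := by
  have h := blockProj_bilin L M (fun y => (x y : ℂ)) (fun y => (x y : ℂ))
  apply Complex.ofReal_injective
  rw [dot_mulVec_eq]
  push_cast
  rw [h]
  unfold blockSum
  push_cast
  exact congrArg _ (Finset.sum_congr rfl fun b _ => by ring)

/-- `0 ≤ ⟨φ, Q*Qφ⟩`. [folklore] -/
theorem blockProj_form_nonneg (x : Tor (fine L M) → ℝ) : 0 ≤ x ⬝ᵥ (blockProj L M *ᵥ x) := by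
  rw [blockProj_form]
  exact mul_nonneg (by positivity) (Finset.sum_nonneg fun b _ => sq_nonneg _)

/-- `⟨φ, Q*Qφ⟩ ≤ ⟨φ, φ⟩` (Cauchy–Schwarz on each block: `Q*Q` is a contraction — indeed the orthogonal projection
onto block-constant fields). [folklore] -/
theorem blockProj_form_le (x : Tor (fine L M) → ℝ) : x ⬝ᵥ (blockProj L M *ᵥ x) ≤ x ⬝ᵥ x := by
  rw [blockProj_form]
  have hLd : (0 : ℝ) < (L : ℝ) ^ d := by
    have hL : (0 : ℝ) < L := by exact_mod_cast Nat.pos_of_ne_zero (NeZero.ne L)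
    positivity
  -- Cauchy–Schwarz on each block: (Σ_j x)² ≤ L^d Σ_j x²
  have hcs : ∀ b : Tor M, blockSum L M x b ^ 2 ≤ (L : ℝ) ^ d * ∑ j : Fin d → Fin L, x (site L M b j) ^ 2 := by
    intro b
    unfold blockSum
    have h := sq_sum_le_card_mul_sum_sq (s := (Finset.univ : Finset (Fin d → Fin L)))
      (f := fun j => x (site L M b j))
    have hcard : (((Finset.univ : Finset (Fin d → Fin L)).card : ℕ) : ℝ) = (L : ℝ) ^ d := by
      rw [Finset.card_univ, Fintype.card_pi]
      simp [Finset.prod_const]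
    rw [hcard] at h
    exact h
  -- Σ_b Σ_j x(site b j)² = Σ_y x y² (block parametrisation)
  have htot : ∑ b : Tor M, ∑ j : Fin d → Fin L, x (site L M b j) ^ 2 = x ⬝ᵥ x := by
    rw [← Fintype.sum_prod_type']
    have e := Fintype.sum_equiv (blockEquiv L M) (fun bj => x (site L M bj.1 bj.2) ^ 2)
      (fun y => x y ^ 2) (fun _ => rfl)
    refine e.trans ?_
    simp [dotProduct, sq]
  calc ((L : ℝ) ^ d)⁻¹ * ∑ b, blockSum L M x b ^ 2
      ≤ ((L : ℝ) ^ d)⁻¹ * ∑ b, (L : ℝ) ^ d * ∑ j : Fin d → Fin L, x (site L M b j) ^ 2 :=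
        mul_le_mul_of_nonneg_left (Finset.sum_le_sum fun b _ => hcs b) (by positivity)
    _ = x ⬝ᵥ x := by rw [← Finset.mul_sum, ← mul_assoc, inv_mul_cancel₀ hLd.ne', one_mul, htot]

/-- The REDUCTION `red : Ω̂ = Π ℤ/(LM_μ) → M̂ = Π ℤ/M_μ` of momenta (the projection `π̂` of [BFKT16] §2, whose
fibres are the alias sets `{p′ + 2πm/L}`). [cite: BFKT2016Bloch, §2] -/
def red (p : Tor (fine L M)) : Tor M :=
  fun μ => ZMod.castHom (dvd_mul_left (M μ) L) (ZMod (M μ)) (p μ)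

/-- `red p_μ = (val p_μ) mod M_μ`. [folklore] -/
theorem red_apply (p : Tor (fine L M)) (μ : Fin d) : red L M p μ = ((p μ).val : ZMod (M μ)) := by
  simp only [red, ZMod.castHom_apply, ZMod.cast_eq_val]

/-- The alias FIBRE over `q ∈ M̂`: all `p ∈ Ω̂` with `red p = q`. [cite: BFKT2016Bloch, §2, Lemma 9] -/
abbrev fib (q : Tor M) : Finset (Tor (fine L M)) := Finset.univ.filter fun p => red L M p = q

/-- `ψ_K(n) = e^{2πi n/K}` for natural `n`. [folklore] -/
theorem stdAddChar_natCast (K : ℕ) [NeZero K] (n : ℕ) :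
    ZMod.stdAddChar (N := K) (n : ZMod K) = Complex.exp (2 * π * Complex.I * n / K) := by
  have h := ZMod.stdAddChar_coe (N := K) (n : ℤ)
  push_cast at h
  exact h

/-- **Corner/reduction duality**: `e^{ip·(L b)} = e^{i red(p)·b}` — a plane wave of `Ω` restricted to the block
corners is the plane wave of `Π ℤ/M_μ` with the reduced momentum ([BFKT16] §2: *"p·x = π̂(p)·x mod 2π for all
x ∈ 𝒳_crs"*). [cite: BFKT2016Bloch, §2] -/
theorem chi_corner (p : Tor (fine L M)) (b : Tor M) :
    chi (fine L M) p (corner L M b) = chi M (red L M p) b := by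
  unfold chi
  refine Finset.prod_congr rfl fun μ _ => ?_
  have hL : (L : ℂ) ≠ 0 := by exact_mod_cast NeZero.ne L
  have hMμ : (M μ : ℂ) ≠ 0 := by exact_mod_cast NeZero.ne (M μ)
  have h1 : p μ * corner L M b μ = (((p μ).val * (L * (b μ).val) : ℕ) : ZMod (fine L M μ)) := by
    simp only [corner, Nat.cast_mul, ZMod.natCast_zmod_val]
  have h2 : red L M p μ * b μ = ((((p μ).val * (b μ).val : ℕ)) : ZMod (M μ)) := by
    rw [Nat.cast_mul, ZMod.natCast_zmod_val, red_apply]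
  rw [h1, h2, stdAddChar_natCast, stdAddChar_natCast]
  congr 1
  simp only [fine]
  push_cast
  field_simp

/-- Orthogonality of the corner waves: `Σ_b e^{ip·Lb} conj e^{ip′·Lb} = |M̂|·[red p = red p′]`. [folklore] -/
theorem sum_chi_corner (p p' : Tor (fine L M)) :
    ∑ b : Tor M, chi (fine L M) p (corner L M b) * conj (chi (fine L M) p' (corner L M b))
      = if red L M p = red L M p' then (Fintype.card (Tor M) : ℂ) else 0 := by
  simp_rw [chi_corner, chi_mul_conj_chi_left, sum_chi]
  by_cases h : red L M p = red L M p'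
  · rw [if_pos (sub_eq_zero.mpr h), if_pos h]
  · rw [if_neg (sub_ne_zero.mpr h), if_neg h]

/-- King's ALIAS WEIGHT `u(p) = L^{−d} Σ_{j ∈ [0,L)^d} e^{ip·j}` — the Fourier transform of the flat block profile
(`q̂(p)` of [BFKT16] Example 10, up to conjugation/centring, which do not change `|u|`). [cite: King1986, (4.14) p.671,
(4.36) p.674; BFKT2016Bloch, Example 10] -/
def u (p : Tor (fine L M)) : ℂ := ((L : ℂ) ^ d)⁻¹ * ∑ j : Fin d → Fin L, chi (fine L M) p (B5Block118.iota L M j)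

/-- `Σ_{j} e^{ip·(Lb + j)} = e^{ip·Lb} · L^d u(p)`. [folklore] -/
theorem sum_chi_site (p : Tor (fine L M)) (b : Tor M) :
    ∑ j : Fin d → Fin L, chi (fine L M) p (site L M b j)
      = chi (fine L M) p (corner L M b) * ((L : ℂ) ^ d * u L M p) := by
  have hLd : (L : ℂ) ^ d ≠ 0 := pow_ne_zero _ (by exact_mod_cast NeZero.ne L)
  unfold u
  rw [mul_inv_cancel_left₀ hLd, Finset.mul_sum]
  exact Finset.sum_congr rfl fun j _ => by rw [site_eq, chi_add_right]

/-- **The momentum kernel of `Q*Q`**: `Q̂*Q(p, p′) = |Ω|·[red p = red p′]·u(p) conj u(p′)` — block diagonal over the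
alias fibres, rank one on each fibre ([BFKT16] Lemma 9(b): `â_k(ℓ,ℓ′) = conj q(k+ℓ) q(k+ℓ′)`).
[cite: BFKT2016Bloch, Lemma 9; King1986, (4.36) p.674] -/
theorem hat_blockProj_eq (p p' : Tor (fine L M)) :
    hat (fine L M) (blockProj L M) p p'
      = (if red L M p = red L M p' then (Fintype.card (Tor (fine L M)) : ℂ) else 0)
          * (u L M p * conj (u L M p')) := by
  have hLd : (L : ℂ) ^ d ≠ 0 := pow_ne_zero _ (by exact_mod_cast NeZero.ne L)
  have h := blockProj_bilin L M (fun y => chi (fine L M) p y) (fun y' => conj (chi (fine L M) p' y'))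
  unfold hat
  rw [h]
  have hconj : ∀ b : Tor M, ∑ j : Fin d → Fin L, conj (chi (fine L M) p' (site L M b j))
      = conj (chi (fine L M) p' (corner L M b)) * ((L : ℂ) ^ d * conj (u L M p')) := by
    intro b
    rw [← map_sum, sum_chi_site, map_mul, map_mul, map_pow, map_natCast]
  simp_rw [sum_chi_site, hconj]
  have hre : ∀ b : Tor M,
      chi (fine L M) p (corner L M b) * ((L : ℂ) ^ d * u L M p)
        * (conj (chi (fine L M) p' (corner L M b)) * ((L : ℂ) ^ d * conj (u L M p')))
      = ((L : ℂ) ^ d * u L M p) * ((L : ℂ) ^ d * conj (u L M p'))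
        * (chi (fine L M) p (corner L M b) * conj (chi (fine L M) p' (corner L M b))) := by
    intro b; ring
  simp_rw [hre]
  rw [← Finset.mul_sum, sum_chi_corner, card_fine]
  push_cast
  by_cases hq : red L M p = red L M p'
  · rw [if_pos hq, if_pos hq]
    field_simp
  · rw [if_neg hq, if_neg hq]
    simp

/-- Regrouping a fibre-diagonal double sum into fibre norms:
`Σ_{p,p′: red p = red p′} F(p) conj F(p′) = Σ_q |Σ_{p ∈ fib q} F(p)|²`. [folklore] -/
theorem sum_ite_red_eq_sum_fib (F : Tor (fine L M) → ℂ) :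
    ∑ p, ∑ p', (if red L M p = red L M p' then F p * conj (F p') else 0)
      = ∑ q : Tor M, ((‖∑ p ∈ fib L M q, F p‖ : ℂ) ^ 2) := by
  simp_rw [← Complex.mul_conj', map_sum, Finset.sum_mul_sum]
  have h1 : ∀ p, ∑ p', (if red L M p = red L M p' then F p * conj (F p') else 0)
      = ∑ p' ∈ fib L M (red L M p), F p * conj (F p') := by
    intro p
    rw [Finset.sum_filter]
    exact Finset.sum_congr rfl fun p' _ => if_congr eq_comm rfl rfl
  simp_rw [h1]
  rw [← Finset.sum_fiberwise Finset.univ (red L M)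
    (fun p => ∑ p' ∈ fib L M (red L M p), F p * conj (F p'))]
  refine Finset.sum_congr rfl fun q _ => Finset.sum_congr rfl fun p hp => ?_
  rw [(Finset.mem_filter.mp hp).2]

/-- **(4.36) CORRECTED — the block form of `⟨φ, Q*Qφ⟩` over the alias fibres**:
`|Ω| ⟨φ, Q*Qφ⟩ = Σ_{q ∈ M̂} |Σ_{p: red p = q} u(p) φ̃(p)|²`  (King's printed right side of (4.36) is the DIAGONAL part
`Σ_p |u(p)|²|φ̃(p)|²` of this).  [cite: BFKT2016Bloch, Lemma 9(a); King1986, (4.36) p.674] -/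
theorem blockProj_fibre_form (x : Tor (fine L M) → ℝ) :
    (Fintype.card (Tor (fine L M)) : ℝ) * (x ⬝ᵥ (blockProj L M *ᵥ x))
      = ∑ q : Tor M, ‖∑ p ∈ fib L M q, u L M p * ft (fine L M) x p‖ ^ 2 := by
  have hc : (Fintype.card (Tor (fine L M)) : ℂ) ≠ 0 := by exact_mod_cast Fintype.card_ne_zero
  have h := transfer (fine L M) (blockProj L M) x
  simp_rw [hat_blockProj_eq] at h
  have h2 : ∑ p, ∑ p', ft (fine L M) x p * conj (ft (fine L M) x p')
        * ((if red L M p = red L M p' then (Fintype.card (Tor (fine L M)) : ℂ) else 0)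
          * (u L M p * conj (u L M p')))
      = (Fintype.card (Tor (fine L M)) : ℂ) * ∑ p, ∑ p',
          (if red L M p = red L M p' then
            (u L M p * ft (fine L M) x p) * conj (u L M p' * ft (fine L M) x p') else 0) := by
    rw [Finset.mul_sum]
    refine Finset.sum_congr rfl fun p _ => ?_
    rw [Finset.mul_sum]
    refine Finset.sum_congr rfl fun p' _ => ?_
    split_ifs
    · rw [map_mul]; ring
    · simp
  rw [h2, sum_ite_red_eq_sum_fib, pow_two, mul_assoc] at h
  have h3 := mul_left_cancel₀ hc h
  exact_mod_cast h3

end Blocks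

/-! ## §3 Fibre geometry: the central alias and the off-centre aliases -/

section Geometry

variable (L : ℕ) [NeZero L] (M : Fin d → ℕ) [hM : ∀ μ, NeZero (M μ)]

/-- The CENTRAL alias of the fibre over `q`: the momentum of `Ω̂` with the same centred representatives
`valMinAbs q_μ ∈ (−M_μ/2, M_μ/2]`, i.e. the unique alias with all `|p′_μ| ≤ π/L` (up to the boundary tie).
[cite: King1986, (4.36)–(4.37) p.674] -/
def z (q : Tor M) : Tor (fine L M) := fun μ => (((q μ).valMinAbs : ℤ) : ZMod (fine L M μ))

omit [NeZero L] hM in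
/-- The central alias lies in its fibre: `red (z q) = q`. [folklore] -/
theorem red_z (q : Tor M) : red L M (z L M q) = q := by
  funext μ
  simp only [red, z, map_intCast, ZMod.coe_valMinAbs]

/-- `z q ∈ fib q`. [folklore] -/
theorem z_mem_fib (q : Tor M) : z L M q ∈ fib L M q := by
  simp [red_z]

/-- The centred representative of the central alias is that of `q`: `valMinAbs (z q)_μ = valMinAbs q_μ`. [folklore] -/
theorem valMinAbs_z (q : Tor M) (μ : Fin d) : (z L M q μ).valMinAbs = (q μ).valMinAbs := by
  unfold z
  rw [ZMod.valMinAbs_spec]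
  refine ⟨rfl, ?_⟩
  have h := (q μ).valMinAbs_mem_Ioc
  simp only [Set.mem_Ioc] at h ⊢
  have hL1 : (1 : ℤ) ≤ L := by exact_mod_cast Nat.one_le_iff_ne_zero.mpr (NeZero.ne L)
  have hM0 : (0 : ℤ) ≤ (M μ : ℤ) := by positivity
  have hfine : ((fine L M μ : ℕ) : ℤ) = (L : ℤ) * (M μ : ℤ) := by simp [fine]
  rw [hfine]
  constructor
  · nlinarith [h.1]
  · nlinarith [h.2]

/-- `2|valMinAbs a| ≤ K` on `ℤ/K`. [folklore] -/
theorem two_mul_abs_valMinAbs_le {K : ℕ} [NeZero K] (a : ZMod K) :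
    2 * |(a.valMinAbs : ℝ)| ≤ K := by
  have h := ZMod.natAbs_valMinAbs_le a
  have h2 : 2 * a.valMinAbs.natAbs ≤ K := by omega
  have h3 : ((2 * a.valMinAbs.natAbs : ℕ) : ℝ) ≤ K := by exact_mod_cast h2
  push_cast at h3
  rw [Nat.cast_natAbs] at h3
  push_cast at h3
  exact h3

/-- **The central alias lies in the small zone**: `|p′_μ(z q)| ≤ π/L` for every `μ` (`p′ = sOf`, the reduced momentum
in `[−π, π]`). [cite: King1986, (4.36) p.674 "|p′| ≤ π/L"] -/
theorem abs_sOf_z_le (q : Tor M) (μ : Fin d) : |sOf (fine L M) (z L M q) μ| ≤ π / L := by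
  have hL : (0 : ℝ) < L := by exact_mod_cast Nat.pos_of_ne_zero (NeZero.ne L)
  have hMr : (0 : ℝ) < M μ := by exact_mod_cast Nat.pos_of_ne_zero (NeZero.ne (M μ))
  have hv := two_mul_abs_valMinAbs_le (q μ)
  unfold sOf
  rw [valMinAbs_z]
  have hfine : ((fine L M μ : ℕ) : ℝ) = (L : ℝ) * (M μ : ℝ) := by simp [fine]
  rw [hfine, abs_div, abs_of_pos (by positivity : (0 : ℝ) < L * M μ), abs_mul, abs_mul,
    abs_of_pos (by norm_num : (0 : ℝ) < 2), abs_of_pos Real.pi_pos, div_le_div_iff₀ (by positivity) hL]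
  have hπL : 0 < π * L := mul_pos Real.pi_pos hL
  calc 2 * π * |((q μ).valMinAbs : ℝ)| * L = (π * L) * (2 * |((q μ).valMinAbs : ℝ)|) := by ring
    _ ≤ (π * L) * M μ := mul_le_mul_of_nonneg_left hv hπL.le
    _ = π * (L * M μ) := by ring

/-- **Every off-centre alias has a large coordinate**: if `red p = q` and `p ≠ z q` then `|p′_μ(p)| ≥ π/L` for some
`μ` (two integers congruent mod `M_μ`, both of modulus `< M_μ/2` resp. `≤ M_μ/2`, coincide).
[cite: King1986, (4.37) p.674; BFKT2016Bloch, §2] -/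
theorem off_centre {q : Tor M} {p : Tor (fine L M)} (hp : p ∈ fib L M q) (hne : p ≠ z L M q) :
    ∃ μ, π / L ≤ |sOf (fine L M) p μ| := by
  by_contra hcon
  push Not at hcon
  apply hne
  funext μ
  have hL : (0 : ℝ) < L := by exact_mod_cast Nat.pos_of_ne_zero (NeZero.ne L)
  have hMr : (0 : ℝ) < M μ := by exact_mod_cast Nat.pos_of_ne_zero (NeZero.ne (M μ))
  have hlt := hcon μ
  set w : ℤ := (p μ).valMinAbs with hw
  set v : ℤ := (q μ).valMinAbs with hv
  -- |w| < M/2 from the small angle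
  have hwlt : 2 * |(w : ℝ)| < M μ := by
    unfold sOf at hlt
    have hfine : ((fine L M μ : ℕ) : ℝ) = (L : ℝ) * (M μ : ℝ) := by simp [fine]
    rw [hfine, abs_div, abs_of_pos (by positivity : (0 : ℝ) < L * M μ), abs_mul, abs_mul,
      abs_of_pos (by norm_num : (0 : ℝ) < 2), abs_of_pos Real.pi_pos,
      div_lt_div_iff₀ (by positivity) hL] at hlt
    have hπL : 0 < π * L := mul_pos Real.pi_pos hL
    have h3 : (π * L) * (2 * |(w : ℝ)|) < (π * L) * M μ := by
      calc (π * L) * (2 * |(w : ℝ)|) = 2 * π * |(w : ℝ)| * L := by ring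
        _ < π * (L * M μ) := hlt
        _ = (π * L) * M μ := by ring
    exact lt_of_mul_lt_mul_left h3 hπL.le
  have hvle : 2 * |(v : ℝ)| ≤ M μ := two_mul_abs_valMinAbs_le (q μ)
  -- congruence w ≡ v (mod M μ)
  have hred : red L M p μ = q μ := congr_fun (Finset.mem_filter.mp hp).2 μ
  have hpw : p μ = ((w : ℤ) : ZMod (fine L M μ)) := (ZMod.coe_valMinAbs (p μ)).symm
  have hcong : ((w : ℤ) : ZMod (M μ)) = ((v : ℤ) : ZMod (M μ)) := by
    have h1 : red L M p μ = ((w : ℤ) : ZMod (M μ)) := by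
      show ZMod.castHom (dvd_mul_left (M μ) L) (ZMod (M μ)) (p μ) = _
      rw [hpw, map_intCast]
    rw [← h1, hred, hv, ZMod.coe_valMinAbs]
  have hdvd : (M μ : ℤ) ∣ v - w := (ZMod.intCast_eq_intCast_iff_dvd_sub w v (M μ)).mp hcong
  have habs : |v - w| < (M μ : ℤ) := by
    have h1 : |((v : ℝ) - (w : ℝ))| < M μ := by
      calc |(v : ℝ) - w| ≤ |(v : ℝ)| + |(w : ℝ)| := abs_sub _ _
        _ < M μ := by linarith
    have h2 : (((|v - w| : ℤ)) : ℝ) < ((M μ : ℤ) : ℝ) := by push_cast; exact h1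
    exact_mod_cast h2
  have hvw : v - w = 0 := Int.eq_zero_of_abs_lt_dvd hdvd habs
  have hwv : w = v := by omega
  rw [hpw, hwv]
  rfl

end Geometry

/-! ## §4 The alias weights: `|u(p)|² = qqSymbol`, the central weight, and the fibre Parseval `Σ_fib |u|² = 1` -/

section Weights

variable (L : ℕ) [NeZero L] (M : Fin d → ℕ) [hM : ∀ μ, NeZero (M μ)]

/-- `Σ_{j∈[0,L)^d} e^{ip·j} = Π_μ Σ_{i<L} e^{2πi p_μ i/(LM_μ)}`. [folklore] -/
theorem sum_chi_offset_eq_prod (p : Tor (fine L M)) :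
    ∑ j : Fin d → Fin L, chi (fine L M) p (B5Block118.iota L M j)
      = ∏ μ, ∑ i : Fin L, ZMod.stdAddChar (N := fine L M μ) (p μ * ((i : ℕ) : ZMod (fine L M μ))) := by
  unfold chi B5Block118.iota
  rw [← Fintype.piFinset_univ, ← Finset.prod_univ_sum (fun _ => (Finset.univ : Finset (Fin L)))
    (fun μ i => ZMod.stdAddChar (N := fine L M μ) (p μ * ((i : ℕ) : ZMod (fine L M μ))))]

omit [NeZero L] in
/-- **One coordinate**: `|L⁻¹ Σ_{i<L} e^{2πi a i/K}|² = sin²(Lθ/2)/(L² sin²(θ/2))` with `θ = 2π·valMinAbs(a)/K`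
(`= 1` at `a = 0`) — in the tree's vocabulary `= B4Strip.uFactorr L 0 (Lθ)`. [cite: King1986, (4.36) p.674;
BFKT2016Bloch, Example 10] -/
theorem norm_sq_avg_char {K : ℕ} [NeZero K] (hL : 1 ≤ L) (a : ZMod K) :
    ‖((L : ℂ))⁻¹ * ∑ i : Fin L, ZMod.stdAddChar (N := K) (a * ((i : ℕ) : ZMod K))‖ ^ 2
      = B4Strip.uFactorr L 0 ((L : ℝ) * (2 * π * (a.valMinAbs : ℝ) / (K : ℝ))) := by
  set v : ℤ := a.valMinAbs with hv
  set φ : ℝ := π * (v : ℝ) / (K : ℝ) with hφ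
  have hK : (0 : ℝ) < K := by exact_mod_cast Nat.pos_of_ne_zero (NeZero.ne K)
  have hLr : (0 : ℝ) < L := by exact_mod_cast (show 0 < L by omega)
  have hsum : ∑ i : Fin L, ZMod.stdAddChar (N := K) (a * ((i : ℕ) : ZMod K)) = dirichletSum L φ := by
    unfold dirichletSum
    rw [Fin.sum_univ_eq_sum_range (fun i => ZMod.stdAddChar (N := K) (a * ((i : ℕ) : ZMod K))) L]
    refine Finset.sum_congr rfl fun i _ => ?_
    have h1 : a * ((i : ℕ) : ZMod K) = (((v * (i : ℤ) : ℤ)) : ZMod K) := by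
      push_cast
      rw [ZMod.coe_valMinAbs]
    rw [h1, ZMod.stdAddChar_coe]
    congr 1
    rw [hφ]
    push_cast
    field_simp
  have hx : (L : ℝ) * (2 * π * (v : ℝ) / (K : ℝ)) = 2 * ((L : ℝ) * φ) := by rw [hφ]; ring
  rw [hsum, norm_mul, mul_pow, norm_inv, Complex.norm_natCast, hx]
  by_cases hv0 : v = 0
  · have hφ0 : φ = 0 := by rw [hφ, hv0]; simp
    have hDS : dirichletSum L φ = L := by
      unfold dirichletSum
      simp [hφ0]
    rw [hDS, Complex.norm_natCast, hφ0, mul_zero, mul_zero, uFactorr_zero_left, if_pos rfl,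
      inv_pow, inv_mul_cancel₀ (pow_ne_zero _ hLr.ne')]
  · have hvabs : 2 * |(v : ℝ)| ≤ K := two_mul_abs_valMinAbs_le a
    have hφabs : |φ| ≤ π / 2 := by
      rw [hφ, abs_div, abs_of_pos hK, abs_mul, abs_of_pos Real.pi_pos, div_le_div_iff₀ hK two_pos]
      nlinarith [Real.pi_pos]
    have hφne : φ ≠ 0 := by
      rw [hφ]
      have : (v : ℝ) ≠ 0 := by exact_mod_cast hv0
      exact div_ne_zero (mul_ne_zero Real.pi_ne_zero this) hK.ne'
    have hsin : Real.sin φ ≠ 0 := by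
      intro h0
      have h1 : -π < φ := by have := (abs_le.mp hφabs).1; linarith [Real.pi_pos]
      have h2 : φ < π := by have := (abs_le.mp hφabs).2; linarith [Real.pi_pos]
      exact hφne ((Real.sin_eq_zero_iff_of_lt_of_lt h1 h2).mp h0)
    have hid := norm_dirichletSum_sq_mul_sin_sq (n := L) hsin
    have hx0 : 2 * ((L : ℝ) * φ) ≠ 0 := mul_ne_zero two_ne_zero (mul_ne_zero hLr.ne' hφne)
    rw [uFactorr_eq_sin_ratio L 0 hx0]
    have e1 : 2 * ((L : ℝ) * φ) / 2 = L * φ := by ring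
    have e2 : (2 * ((L : ℝ) * φ) + 2 * π * ((0 : ℕ) : ℝ)) / (2 * (L : ℝ)) = φ := by
      simp only [Nat.cast_zero, mul_zero, add_zero]
      field_simp
    rw [e1, e2, ← hid]
    have hsin2 : Real.sin φ ^ 2 ≠ 0 := pow_ne_zero _ hsin
    field_simp

/-- **`|u(p)|² = qqSymbol L p′`** (`p′ = sOf p` the reduced momentum): King's printed symbol
`Π_μ 4L^{−2}sin²(½Lp′_μ)/4sin²(½p′_μ)` IS the squared modulus of the alias weight. [cite: King1986, (4.36) p.674] -/
theorem norm_sq_u (hL : 1 ≤ L) (p : Tor (fine L M)) :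
    ‖u L M p‖ ^ 2 = qqSymbol L (sOf (fine L M) p) := by
  unfold u qqSymbol
  rw [sum_chi_offset_eq_prod]
  have hprod : ((L : ℂ) ^ d)⁻¹
      * ∏ μ, ∑ i : Fin L, ZMod.stdAddChar (N := fine L M μ) (p μ * ((i : ℕ) : ZMod (fine L M μ)))
      = ∏ μ, (((L : ℂ))⁻¹
        * ∑ i : Fin L, ZMod.stdAddChar (N := fine L M μ) (p μ * ((i : ℕ) : ZMod (fine L M μ)))) := by
    rw [Finset.prod_mul_distrib, Finset.prod_const, Finset.card_univ, Fintype.card_fin, inv_pow]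
  rw [hprod, norm_prod, ← Finset.prod_pow]
  refine Finset.prod_congr rfl fun μ _ => ?_
  rw [norm_sq_avg_char L hL (p μ)]
  rfl

/-- **The central weight**: `|u(z q)|² ≥ (4/π²)^d` (hypothesis `hu₀` of `endpoint_coercive_fibre`).
[cite: King1986, (4.36) p.674] -/
theorem norm_sq_u_central (hL : 1 ≤ L) (q : Tor M) : (4 / π ^ 2) ^ d ≤ ‖u L M (z L M q)‖ ^ 2 := by
  rw [norm_sq_u L M hL]
  exact qqSymbol_ge hL (abs_sOf_z_le L M q)

/-- Character sums over a FIBRE: `Σ_{p: red p = q} e^{ip·w} = |M̂|⁻¹ Σ_b conj e^{iq·b} Σ_{p∈Ω̂} e^{ip·(Lb + w)}`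
(the fibre indicator written through orthogonality on `M̂` and the corner duality). [folklore] -/
theorem sum_fib_chi (q : Tor M) (w : Tor (fine L M)) :
    ∑ p ∈ fib L M q, chi (fine L M) p w
      = ((Fintype.card (Tor M) : ℂ))⁻¹
        * ∑ b : Tor M, conj (chi M q b) * ∑ p : Tor (fine L M), chi (fine L M) p (corner L M b + w) := by
  have hm : (Fintype.card (Tor M) : ℂ) ≠ 0 := by exact_mod_cast Fintype.card_ne_zero
  -- the indicator of the fibre through orthogonality on `M̂`
  have hind : ∀ p : Tor (fine L M), (if red L M p = q then (1 : ℂ) else 0)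
      = ((Fintype.card (Tor M) : ℂ))⁻¹
        * ∑ b : Tor M, chi (fine L M) p (corner L M b) * conj (chi M q b) := by
    intro p
    simp_rw [chi_corner, chi_mul_conj_chi_left, sum_chi]
    by_cases h : red L M p = q
    · rw [if_pos h, if_pos (sub_eq_zero.mpr h), inv_mul_cancel₀ hm]
    · rw [if_neg h, if_neg (sub_ne_zero.mpr h), mul_zero]
  rw [Finset.sum_filter]
  have h1 : ∀ p : Tor (fine L M), (if red L M p = q then chi (fine L M) p w else 0)
      = (if red L M p = q then (1 : ℂ) else 0) * chi (fine L M) p w := by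
    intro p
    split_ifs <;> simp
  simp_rw [h1, hind, Finset.mul_sum, Finset.sum_mul]
  rw [Finset.sum_comm]
  refine Finset.sum_congr rfl fun b _ => Finset.sum_congr rfl fun p _ => ?_
  rw [chi_add_right]
  ring

/-- `Lb + j − j′ = 0` in `Ω` iff `b = 0` and `j = j′` (blocks tile `Ω`). [folklore] -/
theorem corner_add_iota_sub_iota_eq_zero_iff (b : Tor M) (j j' : Fin d → Fin L) :
    corner L M b + (B5Block118.iota L M j - B5Block118.iota L M j') = 0 ↔ b = 0 ∧ j = j' := by
  rw [add_sub, sub_eq_zero, ← site_eq]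
  have h0 : B5Block118.iota L M j' = site L M 0 j' := by rw [site_eq, corner_zero, zero_add]
  rw [h0]
  constructor
  · intro h
    have := site_injective L M (a₁ := (b, j)) (a₂ := (0, j')) h
    simp only [Prod.mk.injEq] at this
    exact this
  · rintro ⟨rfl, rfl⟩
    rfl

/-- **Fibre Parseval for the alias weights**: `Σ_{p: red p = q} |u(p)|² = 1` for every fibre (hypothesis `hpar` of
`endpoint_coercive_fibre`, with equality; = `Σ_l |u(p′+l)|² = 1`, King p.671, in its genuinely block-diagonal form).
[cite: King1986, (4.14) p.671; BFKT2016Bloch, Lemma 9(a)] -/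
theorem sum_fib_norm_sq_u (q : Tor M) : ∑ p ∈ fib L M q, ‖u L M p‖ ^ 2 = 1 := by
  have hLd : (L : ℂ) ^ d ≠ 0 := pow_ne_zero _ (by exact_mod_cast NeZero.ne L)
  have hm : (Fintype.card (Tor M) : ℂ) ≠ 0 := by exact_mod_cast Fintype.card_ne_zero
  have hC : ∑ p ∈ fib L M q, ((‖u L M p‖ : ℂ) ^ 2) = 1 := by
    simp_rw [← Complex.mul_conj']
    -- |u p|² = L^{-2d} Σ_{j,j'} e^{ip·(j − j')}
    have h1 : ∀ p : Tor (fine L M), u L M p * conj (u L M p)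
        = ((L : ℂ) ^ d)⁻¹ * ((L : ℂ) ^ d)⁻¹
          * ∑ j : Fin d → Fin L, ∑ j' : Fin d → Fin L,
              chi (fine L M) p (B5Block118.iota L M j - B5Block118.iota L M j') := by
      intro p
      unfold u
      rw [map_mul, map_inv₀, map_pow, map_natCast, map_sum, mul_mul_mul_comm, Finset.sum_mul_sum]
      simp_rw [chi_mul_conj_chi]
    simp_rw [h1]
    rw [← Finset.mul_sum, Finset.sum_comm]
    simp_rw [Finset.sum_comm (s := fib L M q), sum_fib_chi, sum_chi_left,
      corner_add_iota_sub_iota_eq_zero_iff]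
    -- collapse the b-sum and the j'-sum
    have h2 : ∀ j j' : Fin d → Fin L,
        ∑ b : Tor M, conj (chi M q b)
          * (if b = 0 ∧ j = j' then (Fintype.card (Tor (fine L M)) : ℂ) else 0)
        = if j = j' then (Fintype.card (Tor (fine L M)) : ℂ) else 0 := by
      intro j j'
      rw [Finset.sum_eq_single 0]
      · rw [B5Block118.chi_zero_right, map_one, one_mul]
        by_cases hj : j = j'
        · rw [if_pos ⟨rfl, hj⟩, if_pos hj]
        · rw [if_neg (fun h => hj h.2), if_neg hj]
      · intro b _ hb
        rw [if_neg (fun h => hb h.1), mul_zero]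
      · intro h; exact absurd (Finset.mem_univ _) h
    simp_rw [h2]
    have h3 : ∀ j : Fin d → Fin L,
        ∑ j' : Fin d → Fin L, ((Fintype.card (Tor M) : ℂ))⁻¹
          * (if j = j' then (Fintype.card (Tor (fine L M)) : ℂ) else 0)
        = (L : ℂ) ^ d := by
      intro j
      rw [Finset.sum_eq_single j]
      · rw [if_pos rfl, card_fine]
        field_simp
      · intro j' _ hj'
        rw [if_neg (Ne.symm hj'), mul_zero]
      · intro h; exact absurd (Finset.mem_univ _) h
    simp_rw [h3]
    rw [Finset.sum_const, Finset.card_univ, Fintype.card_pi]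
    simp only [Fintype.card_fin, Finset.prod_const, Finset.card_univ, nsmul_eq_mul]
    push_cast
    field_simp
  exact_mod_cast hC

end Weights

/-! ## §5 Assembly: (4.33) for translation-invariant operators with King's symbol, hypothesis-free -/

section Assembly

variable (L : ℕ) [NeZero L] (M : Fin d → ℕ) [hM : ∀ μ, NeZero (M μ)]

/-- The normalised Fourier coefficient functionals `c_p(x) = |Ω|^{−1/2} φ̃(p)` (the `c` of `endpoint_coercive_fibre`).
[folklore] -/
def coef (x : Tor (fine L M) → ℝ) (p : Tor (fine L M)) : ℂ :=
  (((Real.sqrt (Fintype.card (Tor (fine L M))))⁻¹ : ℝ) : ℂ) * ft (fine L M) x p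

/-- `|c_p(x)|² = |Ω|⁻¹ |φ̃(p)|²`. [folklore] -/
theorem norm_sq_coef (x : Tor (fine L M) → ℝ) (p : Tor (fine L M)) :
    ‖coef L M x p‖ ^ 2 = ((Fintype.card (Tor (fine L M)) : ℝ))⁻¹ * ‖ft (fine L M) x p‖ ^ 2 := by
  have hc : (0 : ℝ) ≤ Fintype.card (Tor (fine L M)) := by positivity
  unfold coef
  rw [norm_mul, mul_pow, Complex.norm_real, Real.norm_eq_abs, sq_abs, inv_pow, Real.sq_sqrt hc]

/-- **PARSEVAL over the fibres** (hypothesis `hpars` of `endpoint_coercive_fibre`):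
`Σ_q Σ_{p ∈ fib q} |c_p(x)|² = x ⬝ᵥ x`. [cite: King1986, (4.35) p.674] -/
theorem pars_decomp (x : Tor (fine L M) → ℝ) :
    ∑ q : Tor M, ∑ p ∈ fib L M q, ‖coef L M x p‖ ^ 2 = x ⬝ᵥ x := by
  have hc : (Fintype.card (Tor (fine L M)) : ℝ) ≠ 0 := by exact_mod_cast Fintype.card_ne_zero
  rw [Finset.sum_fiberwise Finset.univ (red L M) (fun p => ‖coef L M x p‖ ^ 2)]
  simp_rw [norm_sq_coef]
  rw [← Finset.mul_sum, ← parseval_dot, ← mul_assoc, inv_mul_cancel₀ hc, one_mul]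

/-- **THE BLOCK-DIAGONAL FOURIER REPRESENTATION** (hypothesis `hform` of `endpoint_coercive_fibre`, DERIVED): for a
translation-invariant `T` with symbol `σ(p′)` and any `α`,
`⟨x, (T + α Q*Q) x⟩ = Σ_q [ Σ_{p∈fib q} σ(p′_p)|c_p(x)|² + α |Σ_{p∈fib q} u(p) c_p(x)|² ]`.
[cite: King1986, (4.35)–(4.37) p.674; BFKT2016Bloch, Lemma 1, Lemma 9(a)] -/
theorem form_decomp (T : Matrix (Tor (fine L M)) (Tor (fine L M)) ℝ)
    (hT : ∀ x y t, T (x + t) (y + t) = T x y) (σ : (Fin d → ℝ) → ℝ)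
    (hσ : ∀ p, symb (fine L M) T p = σ (sOf (fine L M) p)) (α : ℝ) (x : Tor (fine L M) → ℝ) :
    x ⬝ᵥ ((T + α • blockProj L M) *ᵥ x)
      = ∑ q : Tor M, (∑ p ∈ fib L M q, σ (sOf (fine L M) p) * ‖coef L M x p‖ ^ 2
          + α * ‖∑ p ∈ fib L M q, u L M p * coef L M x p‖ ^ 2) := by
  have hc : (Fintype.card (Tor (fine L M)) : ℝ) ≠ 0 := by exact_mod_cast Fintype.card_ne_zero
  have hcpos : (0 : ℝ) ≤ Fintype.card (Tor (fine L M)) := by positivity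
  set r : ℝ := (Real.sqrt (Fintype.card (Tor (fine L M))))⁻¹ with hr
  have hr2 : r ^ 2 = ((Fintype.card (Tor (fine L M)) : ℝ))⁻¹ := by
    rw [hr, inv_pow, Real.sq_sqrt hcpos]
  -- split the operator
  rw [Matrix.add_mulVec, dotProduct_add, Matrix.smul_mulVec, dotProduct_smul, smul_eq_mul,
    Finset.sum_add_distrib]
  congr 1
  · -- the translation-invariant part, (4.35)
    have h1 : x ⬝ᵥ (T *ᵥ x)
        = ((Fintype.card (Tor (fine L M)) : ℝ))⁻¹ * ∑ p, symb (fine L M) T p * ‖ft (fine L M) x p‖ ^ 2 := by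
      rw [← transl_form (fine L M) T hT x, ← mul_assoc, inv_mul_cancel₀ hc, one_mul]
    rw [h1, Finset.mul_sum,
      ← Finset.sum_fiberwise Finset.univ (red L M)
        (fun p => ((Fintype.card (Tor (fine L M)) : ℝ))⁻¹ * (symb (fine L M) T p * ‖ft (fine L M) x p‖ ^ 2))]
    refine Finset.sum_congr rfl fun q _ => Finset.sum_congr rfl fun p _ => ?_
    rw [hσ, norm_sq_coef]
    ring
  · -- the block part, (4.36) corrected
    rw [← Finset.mul_sum]
    congr 1
    have h2 : x ⬝ᵥ (blockProj L M *ᵥ x)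
        = ((Fintype.card (Tor (fine L M)) : ℝ))⁻¹
          * ∑ q : Tor M, ‖∑ p ∈ fib L M q, u L M p * ft (fine L M) x p‖ ^ 2 := by
      rw [← blockProj_fibre_form, ← mul_assoc, inv_mul_cancel₀ hc, one_mul]
    rw [h2, Finset.mul_sum]
    refine Finset.sum_congr rfl fun q _ => ?_
    have h3 : ∑ p ∈ fib L M q, u L M p * coef L M x p
        = (r : ℂ) * ∑ p ∈ fib L M q, u L M p * ft (fine L M) x p := by
      rw [Finset.mul_sum]
      refine Finset.sum_congr rfl fun p _ => ?_
      unfold coef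
      rw [← hr]
      ring
    rw [h3, norm_mul, mul_pow, Complex.norm_real, Real.norm_eq_abs, sq_abs, hr2]

/-- **(4.33) ON THE TORUS — King's endpoint coercivity with every Fourier/fibre hypothesis DERIVED.**  Let
`Ω = Π_μ ℤ/(LM_μ)` (`L ≥ 1` the block size), `T₁`, `T₀` real `Ω`-translation-invariant operators whose plane-wave
symbols are King's `Δ^{(k)}(p′) = DeltaEff a₁ N₁ M₁ p′` and `Δ^{(k+n)}(p′) = DeltaEff a₀ N₀ M₀ p′` ((4.5); `a₁, a₀ ≥
a_min > 0`, masses `≥ 0`, `N₁, N₀ ≥ 1`), and `Q*Q = blockProj` the `L`-block-mean projector.  Then BOTH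
`T₁ + aL⁻²Q*Q` and `T₀ + aL⁻²Q*Q` are `Coercive` with the SAME explicit `γ₀^F = gamma0F L a_min a d`
(`EndpointCoercivity.gamma0F`, of order `L⁻²`), uniformly in `k`, `n` and in the torus `M` — hypothesis (a) of
`King1986.lemma45`, obtained from `endpoint_coercive_fibre` with `hform`, `hpars` (§1–§2, §5), `hz`, `hq`, `hoff` (§3),
`hu₀`, `hpar` (§4) all proved here.  The one input is the symbol identification `hσ₁`, `hσ₀` ((4.5), King p.670 /
[Ba 4]). [cite: King1986, (4.33), (4.35)–(4.37) p.674; BFKT2016Bloch, Lemma 1, Lemma 9] -/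
theorem endpoint_coercive_torus (hL : 1 ≤ L) {amin a a₁ a₀ : ℝ} (hamin : 0 < amin) (ha : 0 < a)
    (ha₁ : amin ≤ a₁) (ha₀ : amin ≤ a₀) {N₁ N₀ : ℕ} (hN₁ : 1 ≤ N₁) (hN₀ : 1 ≤ N₀) {M₁ M₀ : ℝ}
    (hM₁ : 0 ≤ M₁) (hM₀ : 0 ≤ M₀)
    (T₁ T₀ : Matrix (Tor (fine L M)) (Tor (fine L M)) ℝ)
    (hT₁ : ∀ x y t, T₁ (x + t) (y + t) = T₁ x y) (hT₀ : ∀ x y t, T₀ (x + t) (y + t) = T₀ x y)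
    (hσ₁ : ∀ p, symb (fine L M) T₁ p = DeltaEff a₁ N₁ M₁ (sOf (fine L M) p))
    (hσ₀ : ∀ p, symb (fine L M) T₀ p = DeltaEff a₀ N₀ M₀ (sOf (fine L M) p)) :
    QGQInverse.Coercive (T₁ + (a * ((L : ℝ) ^ 2)⁻¹) • blockProj L M) (gamma0F L amin a d)
      ∧ QGQInverse.Coercive (T₀ + (a * ((L : ℝ) ^ 2)⁻¹) • blockProj L M) (gamma0F L amin a d) :=
  endpoint_coercive_fibre hL hamin ha ha₁ ha₀ hN₁ hN₀ hM₁ hM₀ _ _ (fib L M) (z L M) (z_mem_fib L M)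
    (fun p => sOf (fine L M) p) (fun _ p _ μ => abs_sOf_le (fine L M) p μ)
    (fun _ _ hp hne => off_centre L M hp hne) (u L M) (fun f => norm_sq_u_central L M hL f)
    (fun f => (sum_fib_norm_sq_u L M f).le) (fun p x => coef L M x p)
    (form_decomp L M T₁ hT₁ (DeltaEff a₁ N₁ M₁) hσ₁ _)
    (form_decomp L M T₀ hT₀ (DeltaEff a₀ N₀ M₀) hσ₀ _)
    (pars_decomp L M)

/-- One-operator form of `endpoint_coercive_torus`: `T + aL⁻²Q*Q` is coercive with `γ₀^F` whenever `T` is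
translation invariant with King's symbol `Δ^{(k)}(p′)`. [cite: King1986, (4.33) p.674] -/
theorem coercive_torus (hL : 1 ≤ L) {amin a a₁ : ℝ} (hamin : 0 < amin) (ha : 0 < a) (ha₁ : amin ≤ a₁)
    {N₁ : ℕ} (hN₁ : 1 ≤ N₁) {M₁ : ℝ} (hM₁ : 0 ≤ M₁)
    (T : Matrix (Tor (fine L M)) (Tor (fine L M)) ℝ) (hT : ∀ x y t, T (x + t) (y + t) = T x y)
    (hσ : ∀ p, symb (fine L M) T p = DeltaEff a₁ N₁ M₁ (sOf (fine L M) p)) :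
    QGQInverse.Coercive (T + (a * ((L : ℝ) ^ 2)⁻¹) • blockProj L M) (gamma0F L amin a d) :=
  (endpoint_coercive_torus L M hL hamin ha ha₁ ha₁ hN₁ hN₁ hM₁ hM₁ T T hT hT hσ hσ).1

end Assembly

end Torus

end Literature.MathematicalPhysics.QuantumFieldTheory.King1986

end
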